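import Mathlib
import HarnessLib

/-!
# An iterated-Cauchy Tannery lemma (child 4 `KLRegimeTwoPointAssemblyV7` of crux K3, tool for stub `stub_asm_int`; seat hubbard-kl-r2d-p2)

For a doubly indexed family of `ℤ`-indexed complex sequences `a L M n`, dominated beyond thresholds by a summable `b n` and
termwise Cauchy in the iterated sense (`∀ n ε, ∃ L₁, ∀ L L' ≥ L₁, ∃ M₁, ∀ M M' ≥ M₁, ‖a L M n − a L' M' n‖ ≤ ε`), the sums `Σ' n, a L M n` are
Cauchy in the same iterated sense (tails by domination, finitely many terms by the hypothesis).  Pure real analysis.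
-/

noncomputable section

namespace Summit.HubbardSuperconductivity.HubbardSuperconductivity.Theorems.TwoPointAssembly

set_option linter.dupNamespace false -- summit = problem name (single-conjunct summit), D-0017

open Finset Filter Topology

/-- **Iterated-Cauchy Tannery lemma.**  See the module docstring. -/
theorem iteratedCauchy_tsum {a : ℕ → ℕ → ℤ → ℂ} {b : ℤ → ℝ} (hb : Summable b) {L₀ : ℕ} {M₀ : ℕ → ℕ}
    (hdom : ∀ L, L₀ ≤ L → ∀ M, M₀ L ≤ M → ∀ n, ‖a L M n‖ ≤ b n)
    (hn : ∀ (n : ℤ) (ε : ℝ), 0 < ε → ∃ L₁ : ℕ, ∀ L L', L₁ ≤ L → L₁ ≤ L' →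
      ∃ M₁ : ℕ, ∀ M M', M₁ ≤ M → M₁ ≤ M' → ‖a L M n - a L' M' n‖ ≤ ε)
    (ε : ℝ) (hε : 0 < ε) :
    ∃ L₁ : ℕ, ∀ L L', L₁ ≤ L → L₁ ≤ L' → ∃ M₁ : ℕ, ∀ M M', M₁ ≤ M → M₁ ≤ M' →
      ‖∑' n, a L M n - ∑' n, a L' M' n‖ ≤ ε := by
  -- a finite set `T` of indices beyond which the dominating tail is `≤ ε/4`
  have htail := tendsto_tsum_compl_atTop_zero b
  rw [Metric.tendsto_atTop] at htail
  obtain ⟨T, hT⟩ := htail (ε / 4) (by positivity)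
  have hT' : ∑' n : {n // n ∉ T}, b n ≤ ε / 4 := by
    have h := hT T le_rfl
    rw [Real.dist_eq, sub_zero] at h
    exact (le_abs_self _).trans h.le
  -- summability and tail bound of `a L M` beyond the thresholds
  have hsum : ∀ L, L₀ ≤ L → ∀ M, M₀ L ≤ M → Summable (a L M) := fun L hL M hM =>
    Summable.of_norm_bounded hb (hdom L hL M hM)
  have htailA : ∀ L, L₀ ≤ L → ∀ M, M₀ L ≤ M → ‖∑' n : {n // n ∉ T}, a L M n‖ ≤ ε / 4 := by
    intro L hL M hM
    have hs : Summable fun n : {n // n ∉ T} => ‖a L M n‖ := (hsum L hL M hM).norm.subtype _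
    calc ‖∑' n : {n // n ∉ T}, a L M n‖ ≤ ∑' n : {n // n ∉ T}, ‖a L M n‖ := norm_tsum_le_tsum_norm hs
      _ ≤ ∑' n : {n // n ∉ T}, b n :=
          hs.tsum_le_tsum (fun n => hdom L hL M hM n) (hb.subtype _)
      _ ≤ ε / 4 := hT'
  -- thresholds for the finitely many indices of `T`
  have hε' : 0 < ε / (2 * (T.card + 1)) := by positivity
  choose L₁f hL₁f using fun n : ℤ => hn n (ε / (2 * (T.card + 1))) hε'
  refine ⟨max L₀ (T.sup L₁f), fun L L' hL hL' => ?_⟩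
  have hL0 : L₀ ≤ L := le_of_max_le_left hL
  have hL0' : L₀ ≤ L' := le_of_max_le_left hL'
  have hLn : ∀ n ∈ T, L₁f n ≤ L := fun n hn => (Finset.le_sup hn).trans (le_of_max_le_right hL)
  have hLn' : ∀ n ∈ T, L₁f n ≤ L' := fun n hn => (Finset.le_sup hn).trans (le_of_max_le_right hL')
  choose M₁f hM₁f using fun n : T => hL₁f n L L' (hLn n n.2) (hLn' n n.2)
  refine ⟨max (max (M₀ L) (M₀ L')) (Finset.univ.sup M₁f), fun M M' hM hM' => ?_⟩
  have hM0 : M₀ L ≤ M := (le_max_left _ _).trans (le_of_max_le_left hM)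
  have hM0' : M₀ L' ≤ M' := (le_max_right _ _).trans (le_of_max_le_left hM')
  have hMn : ∀ n : T, M₁f n ≤ M := fun n => (Finset.le_sup (Finset.mem_univ n)).trans (le_of_max_le_right hM)
  have hMn' : ∀ n : T, M₁f n ≤ M' := fun n => (Finset.le_sup (Finset.mem_univ n)).trans (le_of_max_le_right hM')
  -- split both sums at `T`
  rw [← (hsum L hL0 M hM0).sum_add_tsum_compl (s := T), ← (hsum L' hL0' M' hM0').sum_add_tsum_compl (s := T)]
  have hfin : ‖∑ n ∈ T, a L M n - ∑ n ∈ T, a L' M' n‖ ≤ ε / 2 := by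
    rw [← Finset.sum_sub_distrib]
    calc ‖∑ n ∈ T, (a L M n - a L' M' n)‖ ≤ ∑ n ∈ T, ‖a L M n - a L' M' n‖ := norm_sum_le _ _
      _ ≤ ∑ n ∈ T, ε / (2 * (T.card + 1)) :=
          Finset.sum_le_sum fun n hn => hM₁f ⟨n, hn⟩ M M' (hMn ⟨n, hn⟩) (hMn' ⟨n, hn⟩)
      _ = T.card * (ε / (2 * (T.card + 1))) := by rw [Finset.sum_const, nsmul_eq_mul]
      _ ≤ ε / 2 := by
          rw [show (T.card : ℝ) * (ε / (2 * (T.card + 1))) = ε / 2 * (T.card / (T.card + 1)) by field_simp]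
          exact mul_le_of_le_one_right (by positivity) ((div_le_one (by positivity)).2 (by linarith))
  have key : ∀ (u v u' v' : ℂ), ‖u - u'‖ ≤ ε / 2 → ‖v‖ ≤ ε / 4 → ‖v'‖ ≤ ε / 4 → ‖u + v - (u' + v')‖ ≤ ε := by
    intro u v u' v' h1 h2 h3
    calc ‖u + v - (u' + v')‖ = ‖(u - u') + (v - v')‖ := by congr 1; ring
      _ ≤ ‖u - u'‖ + ‖v - v'‖ := norm_add_le _ _
      _ ≤ ε / 2 + (ε / 4 + ε / 4) := add_le_add h1 ((norm_sub_le _ _).trans (add_le_add h2 h3))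
      _ = ε := by ring
  exact key _ _ _ _ hfin (htailA L hL0 M hM0) (htailA L' hL0' M' hM0')

end Summit.HubbardSuperconductivity.HubbardSuperconductivity.Theorems.TwoPointAssembly

end
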